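import Literature.Topology.FourManifolds.LeeRasmussenConnSumProofs
import HarnessLib

/-!
# The merge map on Lee's canonical generators (Rasmussen's Prop. 4.1 for `D₁ ⊔ D₂ → D₁ # D₂`)

A pure proof file on top of `KhConnSumMerge` / `LeeRasmussenConnSumProofs`. For Gauss diagrams
`G`, `H` (at least one chord each) the merge map `m = mergeMap : C⁰(G) × C⁰(H) → C⁰(G # H)` is the
map induced by the saddle cobordism `D₁ ⊔ D₂ → D₁ # D₂` at the base arcs. Rasmussen (2010),
Prop. 4.1: the map of an elementary saddle cobordism sends Lee's canonical generator `𝔰_o` to a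
*nonzero multiple* of the canonical generator of the compatible orientation, because Lee's basis
multiplies diagonally, `𝐚𝐚 = 2𝐚`, `𝐛𝐛 = -2𝐛`, `𝐚𝐛 = 0` (Lee (2005), §4; Rasmussen (2010), §2.4).
We prove the **exact chain-level identities** behind this for `m`. The library's canonical
generators are the *dual* Lee generators `ŝ_u = (leeCoord 0)⁻¹ e_u` (`leeX_leeCoord_symm_single`),
whose Lee coordinates are the indicator of the degree-zero enhanced state `u`; Lee's monomial itself
is `leeBasis 0 e_u = 2^{#circles(u)} ŝ_u` (`leeBasis_single`).

* `§ Glued`: degree-zero enhanced states of `G # H` over a pair of degree-zero states are glued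
  (`exists_eq_glue₀`), gluing is injective, and `m(x, y)` is supported on glued states; hence **the
  Lee coordinates of `m(x, y)` vanish off the glued states** (`leeCoord_mergeMap_eq_zero_of_not_exists`),
  which together with `leeCoord_mergeMap_glue` computes all of them.
* `§ Multiplicativity`: **`m(ŝ_{u₁}, ŝ_{u₂}) = leeSign (u₁ B) · ŝ_{glue u₁ u₂}`** if the labels of
  `u₁`, `u₂` on the base arcs agree (`mergeMap_leeCoord_symm_single`), **`= 0`** if they differ
  (`mergeMap_leeCoord_symm_single_of_ne`); in Lee's own normalisation
  `m(𝐬_{u₁}, 𝐬_{u₂}) = 2 leeSign (u₁ B) · 𝐬_{glue u₁ u₂}` (`mergeMap_leeBasis_single`): the scalars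
  `± 2` of `𝐚𝐚 = 2𝐚`, `𝐛𝐛 = -2𝐛`.
* `§ Canonical`: for Lee's canonical states `leeState₀ t` (label `t` on arc `0`, hence `¬ t` on the
  base arc): **`m(ŝ_t(G), ŝ_t(H)) = leeSign (¬t) · ŝ_t(G # H)`** (`mergeMap_leeState₀`; `-1` for
  `t = false`, `+1` for `t = true`), **`m(ŝ_t(G), ŝ_{t'}(H)) = 0` for `t ≠ t'`**
  (`mergeMap_leeState₀_of_ne`), `m(𝐬_t, 𝐬_t) = ± 2 𝐬_t` for Lee's monomials
  (`mergeMap_leeBasis_leeState₀`); consequently `m(ŝ_t, ŝ_t)` is a cycle, not a boundary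
  (`mergeMap_leeState₀_not_mem_range`), with nonzero class in `Kh'⁰(G # H)`
  (`mk_mergeMap_leeState₀_ne_zero`, `mk_mergeMap_leeState₀_eq_smul`), and `m(z₁, z₂)` is not a
  boundary once `z₁`, `z₂` have a nonzero canonical Lee coordinate for the same `t`
  (`mergeMap_not_mem_range_of_leeCoord_ne_zero`: the step "Prop. 4.1 ⇒ `[m(z₁, z₂)] ≠ 0`" of
  `add_le_rasmussenInvariant_connSum`).

Hypotheses: `0 < G.n`, `0 < H.n` (as in `KhConnSumMerge`); Gauss parity only where Lee's canonical
states occur. No `def`, no named fact.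

## References

* J. Rasmussen, *Khovanov homology and the slice genus*, Invent. Math. 182 (2010) 419–447
  (arXiv:math/0402131): §2.4 (Lee's basis), Prop. 3.11 (connected sums), Prop. 4.1 (canonical
  generators under elementary cobordisms). [cite: Rasmussen2010, Prop. 4.1]
* E. S. Lee, *An endomorphism of the Khovanov invariant*, Adv. Math. 197 (2005) 554–586, §4
  (the basis `𝐚 = X + 𝟙`, `𝐛 = X - 𝟙`), Thm. 4.2. [cite: Lee2005, §4]
* M. Khovanov, *A categorification of the Jones polynomial*, Duke Math. J. 101 (2000), §7.4.
  [cite: Khovanov2000, §7.4]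
-/

open Function Finset

namespace Literature.Topology.FourManifolds

namespace GaussDiagram

variable (G H : GaussDiagram) (hG : 0 < G.n) (hH : 0 < H.n)

/-! ## Two facts on Lee's coordinates (every Gauss diagram) -/

section Coord

/-- **Lee's coordinates are fibrewise**: if the cochain `x` vanishes on all enhanced states over
the state of `u`, its Lee coordinate at `u` vanishes (the pairing with the Lee monomial
`u = (τ, ℓ)` only involves the values of `x` over `τ`). Lee (2005), §4.4. [cite: Lee2005, §4.4] -/
theorem leeCoord_apply_eq_zero_of_forall_state_eq {K : GaussDiagram} (k : ℤ)
    {x : K.degStates k → ℚ} {u : K.degStates k}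
    (h : ∀ s : K.degStates k, s.1.state = u.1.state → x s = 0) : K.leeCoord k x u = 0 := by
  rw [leeCoord_apply_eq_sum_lab]
  refine Finset.sum_eq_zero fun mu _ ↦ mul_eq_zero_of_right _ (h _ ?_)
  rfl

/-- **Lee's monomials versus the dual generators**: Lee's monomial `leeBasis k e_u` of the enhanced
state `u = (σ, ℓ)` (labels `𝐚 = 𝟙 + X`, `𝐛 = -𝟙 + X` on the circles of `σ`) is `2^{#circles(σ)}`
times the dual generator `(leeCoord k)⁻¹ e_u` (whose Lee coordinates are the indicator of `u`), by
the orthogonality `Mᵀ M = diag (2^{#circles})` (`leeBasisMat_transpose_mul`). [cite: Lee2005, §4.4] -/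
theorem leeBasis_single {K : GaussDiagram} (k : ℤ) (u : K.degStates k) :
    K.leeBasis k (Pi.single u 1) =
      (2 : ℚ) ^ K.circleCount u.1.state • (K.leeCoord k).symm (Pi.single u 1) := by
  apply (K.leeCoord k).injective
  rw [map_smul, LinearEquiv.apply_symm_apply, leeCoord_apply, leeBasis_apply,
    ← Matrix.toLin'_mul_apply, leeBasisMat_transpose_mul]
  funext s
  rw [Matrix.toLin'_apply, Matrix.mulVec_diagonal, Pi.smul_apply, smul_eq_mul, Pi.single_apply]
  split_ifs with h
  · rw [h]
  · rw [mul_zero, mul_zero]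

end Coord

/-! ## Glued states and the support of the merge map -/

section Glued

include hG in
/-- The label of Lee's canonical state `t` on the base arc is `¬ t` (the base arc has the odd number
`2 n - 1`; arc `0` carries `t`). [cite: Rasmussen2010, §2.4] -/
theorem leeState_label_baseArc_eq_not (hpG : ∀ i, (G.overPos i).val % 2 ≠ (G.underPos i).val % 2)
    (t : Bool) : (G.leeState hpG t).label G.baseArc = !t := by
  have h1 : (2 * G.n - 1) % 2 = 1 := by omega
  simp [leeState, altLabel, val_baseArc, h1]

variable {G H}

/-- **Gluing of enhanced states is injective** (the blocks are recovered by restriction to the arcs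
of `G`, resp. `H`). [folklore] -/
theorem eq_of_glue_eq_glue {u₁ v₁ : G.EnhancedState} {u₂ v₂ : H.EnhancedState}
    {hu : u₁.label G.baseArc = u₂.label H.baseArc} {hv : v₁.label G.baseArc = v₂.label H.baseArc}
    (h : glue hG hH u₁ u₂ hu = glue hG hH v₁ v₂ hv) : u₁ = v₁ ∧ u₂ = v₂ := by
  have hs : (Fin.append u₁.state u₂.state : (G.connSum H).State) = Fin.append v₁.state v₂.state :=
    congrArg EnhancedState.state h
  have hl : G.glueLab H hG hH u₁.label u₂.label = G.glueLab H hG hH v₁.label v₂.label :=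
    congrArg EnhancedState.label h
  refine ⟨EnhancedState.ext' ?_ ?_, EnhancedState.ext' ?_ ?_⟩
  · funext i
    simpa only [Fin.append_left] using congrFun hs (Fin.castAdd H.n i)
  · funext a
    simpa only [glueLab_inlArc] using congrFun hl (G.inlArc H a)
  · funext j
    simpa only [Fin.append_right] using congrFun hs (Fin.natAdd G.n j)
  · funext b
    simpa only [glueLab_inrArc] using congrFun hl (G.inrArc H b)

/-- Gluing of degree-zero enhanced states is injective. [folklore] -/
theorem eq_of_glue₀_eq_glue₀ {u₁ v₁ : G.degStates 0} {u₂ v₂ : H.degStates 0}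
    {hu : u₁.1.label G.baseArc = u₂.1.label H.baseArc}
    {hv : v₁.1.label G.baseArc = v₂.1.label H.baseArc}
    (h : glue₀ hG hH u₁ u₂ hu = glue₀ hG hH v₁ v₂ hv) : u₁ = v₁ ∧ u₂ = v₂ := by
  have h' : glue hG hH u₁.1 u₂.1 hu = glue hG hH v₁.1 v₂.1 hv := congrArg Subtype.val h
  exact ⟨Subtype.ext (eq_of_glue_eq_glue hG hH h').1, Subtype.ext (eq_of_glue_eq_glue hG hH h').2⟩

variable (G H)

/-- **Degree-zero enhanced states over a pair of degree-zero states are glued.** If the state of a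
degree-zero enhanced state `u` of `G # H` is the pair `(σ₁, σ₂)` of states of degree-zero enhanced
states of the blocks, then `u = glue₀ u₁ u₂` with `u₁`, `u₂` over `σ₁`, `σ₂` agreeing on the base
arcs: the labelling of `u` restricts to labellings of the blocks (the circles of `(σ₁, σ₂)` are those
of the blocks with the base circles united, `connSum_surg`). [cite: Rasmussen2010, Lemma 3.8] -/
theorem exists_eq_glue₀ (u : (G.connSum H).degStates 0) (v₁ : G.degStates 0) (v₂ : H.degStates 0)
    (hu : u.1.state = Fin.append v₁.1.state v₂.1.state) :
    ∃ (u₁ : G.degStates 0) (u₂ : H.degStates 0) (hb : u₁.1.label G.baseArc = u₂.1.label H.baseArc),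
      u = glue₀ hG hH u₁ u₂ hb := by
  obtain ⟨⟨τ, ℓ, hℓ⟩, h0⟩ := u
  obtain ⟨⟨σ₁, ℓ₁, hℓ₁⟩, h0₁⟩ := v₁
  obtain ⟨⟨σ₂, ℓ₂, hℓ₂⟩, h0₂⟩ := v₂
  dsimp only at hu
  subst hu
  have hlab : (G.connSum H).IsLabelOf (Fin.append σ₁ σ₂) ℓ := hℓ
  have hc := lab_of_isLabelOf hlab
  have h₁ : G.IsLabelOf σ₁ (ℓ ∘ G.inlArc H) := fun a b hab ↦
    hc _ _ ((G.circleOf_inlArc_eq_iff H σ₁ σ₂ hG hH a b).2 (circleOf_eq_iff.2 hab.reachable))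
  have h₂ : H.IsLabelOf σ₂ (ℓ ∘ G.inrArc H) := fun a b hab ↦
    hc _ _ ((G.circleOf_inrArc_eq_iff H σ₁ σ₂ hG hH a b).2 (circleOf_eq_iff.2 hab.reachable))
  have hb : (ℓ ∘ G.inlArc H) G.baseArc = (ℓ ∘ G.inrArc H) H.baseArc :=
    hc _ _ ((G.circleOf_inlArc_eq_inrArc_iff H σ₁ σ₂ hG hH G.baseArc H.baseArc).2 ⟨rfl, rfl⟩)
  refine ⟨⟨⟨σ₁, ℓ ∘ G.inlArc H, h₁⟩, h0₁⟩, ⟨⟨σ₂, ℓ ∘ G.inrArc H, h₂⟩, h0₂⟩, hb, ?_⟩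
  apply Subtype.ext
  refine EnhancedState.ext' rfl ?_
  change ℓ = G.glueLab H hG hH (ℓ ∘ G.inlArc H) (ℓ ∘ G.inrArc H)
  funext r
  obtain ⟨x, rfl⟩ := (G.arcEquiv H hG hH).surjective r
  rcases x with a | b
  · rw [arcEquiv_inl, glueLab_inlArc]; rfl
  · rw [arcEquiv_inr, glueLab_inrArc]; rfl

/-- **The merge map is supported on glued states**: if `m(x, y)` does not vanish at a degree-zero
enhanced state `s` of `G # H`, then `s` is glued from degree-zero enhanced states of the blocks (a
nonzero entry `m(s₁, s₂; s)` sits over the pair of states, `state_eq_of_mergeEntry_ne_zero`).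
[cite: Rasmussen2010, Lemma 3.8] -/
theorem exists_eq_glue₀_of_mergeMap_apply_ne_zero {R : Type} [CommRing R] (h t : R)
    (x : G.degStates 0 → R) (y : H.degStates 0 → R) (s : (G.connSum H).degStates 0)
    (hs : G.mergeMap H hG hH h t 0 0 0 x y s ≠ 0) :
    ∃ (u₁ : G.degStates 0) (u₂ : H.degStates 0) (hb : u₁.1.label G.baseArc = u₂.1.label H.baseArc),
      s = glue₀ hG hH u₁ u₂ hb := by
  rw [mergeMap_apply] at hs
  obtain ⟨s₁, -, hs₁⟩ := Finset.exists_ne_zero_of_sum_ne_zero hs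
  obtain ⟨s₂, -, hs₂⟩ := Finset.exists_ne_zero_of_sum_ne_zero hs₁
  exact G.exists_eq_glue₀ H hG hH s s₁ s₂
    (G.state_eq_of_mergeEntry_ne_zero H hG hH h t (right_ne_zero_of_mul hs₂))

/-- **The Lee coordinates of `m(x, y)` vanish off the glued states** (with `leeCoord_mergeMap_glue`,
`⟨m(x, y), glue u₁ u₂⟩ = leeSign ⟨x, u₁⟩ ⟨y, u₂⟩`, this computes all). [cite: Rasmussen2010, Prop. 4.1] -/
theorem leeCoord_mergeMap_eq_zero_of_not_exists (x : G.degStates 0 → ℚ) (y : H.degStates 0 → ℚ)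
    (u : (G.connSum H).degStates 0)
    (hu : ¬ ∃ (u₁ : G.degStates 0) (u₂ : H.degStates 0)
      (hb : u₁.1.label G.baseArc = u₂.1.label H.baseArc), u = glue₀ hG hH u₁ u₂ hb) :
    (G.connSum H).leeCoord 0 (G.mergeMap H hG hH 0 1 0 0 0 x y) u = 0 := by
  refine leeCoord_apply_eq_zero_of_forall_state_eq 0 fun s hs ↦ ?_
  by_contra hne
  obtain ⟨u₁, u₂, hb, rfl⟩ := G.exists_eq_glue₀_of_mergeMap_apply_ne_zero H hG hH 0 1 x y s hne
  exact hu (G.exists_eq_glue₀ H hG hH u u₁ u₂ hs.symm)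

end Glued

/-! ## Multiplicativity of the dual Lee generators under the merge map -/

section Multiplicativity

/-- **The merge map multiplies dual Lee generators diagonally.** For degree-zero enhanced states
`u₁` of `G` and `u₂` of `H` with the same label on the base arcs,
`m(ŝ_{u₁}, ŝ_{u₂}) = leeSign (u₁ B) · ŝ_{glue u₁ u₂}` exactly, where `ŝ_u = (leeCoord 0)⁻¹ e_u`:
both sides have the same Lee coordinates (`leeCoord_mergeMap_glue` on glued states,
`leeCoord_mergeMap_eq_zero_of_not_exists` off them) and `leeCoord 0` is a linear isomorphism
(`𝐚𝐚 = 2𝐚`, `𝐛𝐛 = -2𝐛` on the merged base circle, dual coordinates). [cite: Rasmussen2010, Prop. 4.1] -/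
theorem mergeMap_leeCoord_symm_single (u₁ : G.degStates 0) (u₂ : H.degStates 0)
    (hb : u₁.1.label G.baseArc = u₂.1.label H.baseArc) :
    G.mergeMap H hG hH 0 1 0 0 0 ((G.leeCoord 0).symm (Pi.single u₁ 1))
        ((H.leeCoord 0).symm (Pi.single u₂ 1)) =
      leeSign (u₁.1.label G.baseArc) •
        ((G.connSum H).leeCoord 0).symm (Pi.single (glue₀ hG hH u₁ u₂ hb) 1) := by
  apply ((G.connSum H).leeCoord 0).injective
  rw [map_smul, LinearEquiv.apply_symm_apply]
  funext u
  rw [Pi.smul_apply, smul_eq_mul]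
  by_cases hu : ∃ (v₁ : G.degStates 0) (v₂ : H.degStates 0)
      (hb' : v₁.1.label G.baseArc = v₂.1.label H.baseArc), u = glue₀ hG hH v₁ v₂ hb'
  · obtain ⟨v₁, v₂, hb', rfl⟩ := hu
    rw [G.leeCoord_mergeMap_glue H hG hH, LinearEquiv.apply_symm_apply, LinearEquiv.apply_symm_apply]
    by_cases h : v₁ = u₁ ∧ v₂ = u₂
    · obtain ⟨rfl, rfl⟩ := h
      simp only [Pi.single_eq_same, mul_one]
    · have hne : glue₀ hG hH v₁ v₂ hb' ≠ glue₀ hG hH u₁ u₂ hb := fun heq ↦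
        h (eq_of_glue₀_eq_glue₀ hG hH heq)
      rw [Pi.single_eq_of_ne hne, mul_zero]
      rcases not_and_or.1 h with h₁ | h₂
      · rw [Pi.single_eq_of_ne h₁, mul_zero, zero_mul]
      · rw [Pi.single_eq_of_ne h₂, mul_zero]
  · rw [G.leeCoord_mergeMap_eq_zero_of_not_exists H hG hH _ _ u hu, Pi.single_eq_of_ne, mul_zero]
    rintro rfl
    exact hu ⟨u₁, u₂, hb, rfl⟩

/-- **`𝐚𝐛 = 0`: the merge map kills dual Lee generators with different labels on the base arcs.**
[cite: Rasmussen2010, Prop. 4.1] -/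
theorem mergeMap_leeCoord_symm_single_of_ne (u₁ : G.degStates 0) (u₂ : H.degStates 0)
    (hb : u₁.1.label G.baseArc ≠ u₂.1.label H.baseArc) :
    G.mergeMap H hG hH 0 1 0 0 0 ((G.leeCoord 0).symm (Pi.single u₁ 1))
        ((H.leeCoord 0).symm (Pi.single u₂ 1)) = 0 := by
  apply ((G.connSum H).leeCoord 0).injective
  rw [map_zero]
  funext u
  rw [Pi.zero_apply]
  by_cases hu : ∃ (v₁ : G.degStates 0) (v₂ : H.degStates 0)
      (hb' : v₁.1.label G.baseArc = v₂.1.label H.baseArc), u = glue₀ hG hH v₁ v₂ hb'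
  · obtain ⟨v₁, v₂, hb', rfl⟩ := hu
    rw [G.leeCoord_mergeMap_glue H hG hH, LinearEquiv.apply_symm_apply, LinearEquiv.apply_symm_apply]
    by_cases h₁ : v₁ = u₁
    · subst h₁
      have h₂ : v₂ ≠ u₂ := by
        rintro rfl
        exact hb hb'
      rw [Pi.single_eq_of_ne h₂, mul_zero]
    · rw [Pi.single_eq_of_ne h₁, mul_zero, zero_mul]
  · exact G.leeCoord_mergeMap_eq_zero_of_not_exists H hG hH _ _ u hu

/-- **The merge map on Lee's monomials, Lee's normalisation**: for Lee's monomials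
`𝐬_u = leeBasis 0 e_u` (products of `𝐚 = X + 𝟙`, `𝐛 = X - 𝟙` over the circles),
`m(𝐬_{u₁}, 𝐬_{u₂}) = 2 leeSign (u₁ B) · 𝐬_{glue u₁ u₂}` — the structure constants `𝐚𝐚 = 2𝐚`,
`𝐛𝐛 = -2𝐛` (via `leeBasis_single` and `circleCount_connSum`). [cite: Rasmussen2010, §2.4] -/
theorem mergeMap_leeBasis_single (u₁ : G.degStates 0) (u₂ : H.degStates 0)
    (hb : u₁.1.label G.baseArc = u₂.1.label H.baseArc) :
    G.mergeMap H hG hH 0 1 0 0 0 (G.leeBasis 0 (Pi.single u₁ 1)) (H.leeBasis 0 (Pi.single u₂ 1)) =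
      (2 * leeSign (u₁.1.label G.baseArc)) •
        (G.connSum H).leeBasis 0 (Pi.single (glue₀ hG hH u₁ u₂ hb) 1) := by
  rw [leeBasis_single, leeBasis_single, leeBasis_single, LinearMap.map_smul₂, LinearMap.map_smul,
    G.mergeMap_leeCoord_symm_single H hG hH u₁ u₂ hb, smul_smul, smul_smul, smul_smul]
  congr 1
  have hc := G.circleCount_connSum H u₁.1.state u₂.1.state hG hH
  change (2 : ℚ) ^ G.circleCount u₁.1.state * (2 : ℚ) ^ H.circleCount u₂.1.state * _ =
    2 * _ * (2 : ℚ) ^ (G.connSum H).circleCount (Fin.append u₁.1.state u₂.1.state)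
  rw [← pow_add, ← hc, pow_succ]
  ring

end Multiplicativity

/-! ## Lee's canonical generators under the merge map (Rasmussen's Prop. 4.1) -/

section Canonical

/-- **Rasmussen's Prop. 4.1 for the merge map, exact form.** For Lee's canonical states `𝔰_t` of
`G`, `H`, `G # H` (label `t` on arc `0`; dual generators `ŝ_t = (leeCoord 0)⁻¹ e_{𝔰_t}`):
`m(ŝ_t(G), ŝ_t(H)) = leeSign (¬t) · ŝ_t(G # H)`, i.e. `-ŝ_false(G # H)` for `t = false` (both base
circles carry `𝐛`, `𝐛𝐛 = -2𝐛`) and `+ŝ_true(G # H)` for `t = true` (`𝐚𝐚 = 2𝐚`); the canonical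
states of `G # H` are glued from the blocks' (`leeState₀_connSum`). [cite: Rasmussen2010, Prop. 4.1] -/
theorem mergeMap_leeState₀ (hpG : ∀ i, (G.overPos i).val % 2 ≠ (G.underPos i).val % 2)
    (hpH : ∀ j, (H.overPos j).val % 2 ≠ (H.underPos j).val % 2)
    (hpD : ∀ k, ((G.connSum H).overPos k).val % 2 ≠ ((G.connSum H).underPos k).val % 2) (t : Bool) :
    G.mergeMap H hG hH 0 1 0 0 0 ((G.leeCoord 0).symm (Pi.single (G.leeState₀ hpG t) 1))
        ((H.leeCoord 0).symm (Pi.single (H.leeState₀ hpH t) 1)) =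
      leeSign (!t) •
        ((G.connSum H).leeCoord 0).symm (Pi.single ((G.connSum H).leeState₀ hpD t) 1) := by
  have hb : (G.leeState₀ hpG t).1.label G.baseArc = !t := G.leeState_label_baseArc_eq_not hG hpG t
  rw [G.leeState₀_connSum H hG hH hpG hpH hpD t,
    G.mergeMap_leeCoord_symm_single H hG hH _ _ (G.leeState_label_baseArc H hG hH hpG hpH t), hb]

/-- **Rasmussen's Prop. 4.1, vanishing part: `m(ŝ_t(G), ŝ_{t'}(H)) = 0` for `t ≠ t'`** (the base
circles carry `𝐚` and `𝐛`, and `𝐚𝐛 = 0`). [cite: Rasmussen2010, Prop. 4.1] -/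
theorem mergeMap_leeState₀_of_ne (hpG : ∀ i, (G.overPos i).val % 2 ≠ (G.underPos i).val % 2)
    (hpH : ∀ j, (H.overPos j).val % 2 ≠ (H.underPos j).val % 2) {t t' : Bool} (htt' : t ≠ t') :
    G.mergeMap H hG hH 0 1 0 0 0 ((G.leeCoord 0).symm (Pi.single (G.leeState₀ hpG t) 1))
        ((H.leeCoord 0).symm (Pi.single (H.leeState₀ hpH t') 1)) = 0 := by
  refine G.mergeMap_leeCoord_symm_single_of_ne H hG hH _ _ fun h ↦ htt' (Bool.not_inj ?_)
  rwa [← G.leeState_label_baseArc_eq_not hG hpG t, ← H.leeState_label_baseArc_eq_not hH hpH t']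

/-- **Prop. 4.1 in Lee's normalisation**: for Lee's canonical generators
`𝐬_t = leeBasis 0 e_{𝔰_t}` themselves, `m(𝐬_t(G), 𝐬_t(H)) = 2 leeSign (¬t) · 𝐬_t(G # H)`
(scalar `-2` for `t = false`, `+2` for `t = true`). [cite: Rasmussen2010, Prop. 4.1] -/
theorem mergeMap_leeBasis_leeState₀ (hpG : ∀ i, (G.overPos i).val % 2 ≠ (G.underPos i).val % 2)
    (hpH : ∀ j, (H.overPos j).val % 2 ≠ (H.underPos j).val % 2)
    (hpD : ∀ k, ((G.connSum H).overPos k).val % 2 ≠ ((G.connSum H).underPos k).val % 2) (t : Bool) :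
    G.mergeMap H hG hH 0 1 0 0 0 (G.leeBasis 0 (Pi.single (G.leeState₀ hpG t) 1))
        (H.leeBasis 0 (Pi.single (H.leeState₀ hpH t) 1)) =
      (2 * leeSign (!t)) • (G.connSum H).leeBasis 0 (Pi.single ((G.connSum H).leeState₀ hpD t) 1) := by
  have hb : (G.leeState₀ hpG t).1.label G.baseArc = !t := G.leeState_label_baseArc_eq_not hG hpG t
  rw [G.leeState₀_connSum H hG hH hpG hpH hpD t,
    G.mergeMap_leeBasis_single H hG hH _ _ (G.leeState_label_baseArc H hG hH hpG hpH t), hb]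

/-- The merged canonical generators are degree-zero Lee cycles of `G # H` (`m` is a chain map under
the merge/split dichotomy, which Gauss parity guarantees). [cite: Rasmussen2010, Lemma 3.8] -/
theorem mergeMap_leeState₀_mem_leeCycles (hpG : ∀ i, (G.overPos i).val % 2 ≠ (G.underPos i).val % 2)
    (hpH : ∀ j, (H.overPos j).val % 2 ≠ (H.underPos j).val % 2) (t t' : Bool) :
    G.mergeMap H hG hH 0 1 0 0 0 ((G.leeCoord 0).symm (Pi.single (G.leeState₀ hpG t) 1))
        ((H.leeCoord 0).symm (Pi.single (H.leeState₀ hpH t') 1)) ∈ (G.connSum H).leeCycles :=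
  G.mergeMap_mem_ker H hG hH 0 1 (fun _ _ h ↦ isMergeAt_or_isSplitAt_of_overPos_mod_two_ne hpG h)
    (fun _ _ h ↦ isMergeAt_or_isSplitAt_of_overPos_mod_two_ne hpH h) (i := 0) (j := 0) (k := 0)
    (by norm_num) (0 + 1) (leeCoord_symm_single_mem_leeCycles (G.not_free_leeState hpG t))
    (leeCoord_symm_single_mem_leeCycles (H.not_free_leeState hpH t'))

/-- **"Prop. 4.1 ⇒ not a boundary"**: if degree-zero cochains `z₁` of `G` and `z₂` of `H` have
nonzero Lee coordinates at the canonical states `𝔰_t(G)`, `𝔰_t(H)` for one and the same `t`, then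
`m(z₁, z₂)` is not a Lee boundary of `G # H`: its Lee coordinate at `𝔰_t(G # H)` is the nonzero
product `leeSign · ⟨z₁, 𝔰_t⟩ · ⟨z₂, 𝔰_t⟩` (`leeCoord_mergeMap_glue`), while boundaries have
vanishing canonical coordinates (`leeCoord_apply_eq_zero_of_mem_range`); the step of
`add_le_rasmussenInvariant_connSum` making `[m(z₁, z₂)] ≠ 0`. [cite: Rasmussen2010, Prop. 4.1] -/
theorem mergeMap_not_mem_range_of_leeCoord_ne_zero
    (hpG : ∀ i, (G.overPos i).val % 2 ≠ (G.underPos i).val % 2)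
    (hpH : ∀ j, (H.overPos j).val % 2 ≠ (H.underPos j).val % 2) {z₁ : G.degStates 0 → ℚ}
    {z₂ : H.degStates 0 → ℚ} (t : Bool) (h₁ : G.leeCoord 0 z₁ (G.leeState₀ hpG t) ≠ 0)
    (h₂ : H.leeCoord 0 z₂ (H.leeState₀ hpH t) ≠ 0) :
    G.mergeMap H hG hH 0 1 0 0 0 z₁ z₂ ∉
      LinearMap.range ((G.connSum H).khovanovD ℚ 0 1 (0 - 1) 0) := by
  intro hmem
  have hpD := G.connSum_parity H hpG hpH
  have h0 := leeCoord_apply_eq_zero_of_mem_range hmem (s := (G.connSum H).leeState₀ hpD t)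
    ((G.connSum H).not_free_leeState hpD t)
  rw [G.leeState₀_connSum H hG hH hpG hpH hpD t, G.leeCoord_mergeMap_glue H hG hH] at h0
  exact mul_ne_zero (mul_ne_zero (leeSign_ne_zero _) h₁) h₂ h0

/-- **The merged canonical generator is not a boundary**: `m(ŝ_t(G), ŝ_t(H)) ∉ im d₋₁` in
`C⁰(G # H)` (it is `± ŝ_t(G # H)`, whose canonical Lee coordinate is `1`). Rasmussen (2010),
Prop. 4.1 / Prop. 3.11. [cite: Rasmussen2010, Prop. 4.1] -/
theorem mergeMap_leeState₀_not_mem_range (hpG : ∀ i, (G.overPos i).val % 2 ≠ (G.underPos i).val % 2)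
    (hpH : ∀ j, (H.overPos j).val % 2 ≠ (H.underPos j).val % 2) (t : Bool) :
    G.mergeMap H hG hH 0 1 0 0 0 ((G.leeCoord 0).symm (Pi.single (G.leeState₀ hpG t) 1))
        ((H.leeCoord 0).symm (Pi.single (H.leeState₀ hpH t) 1)) ∉
      LinearMap.range ((G.connSum H).khovanovD ℚ 0 1 (0 - 1) 0) := by
  refine G.mergeMap_not_mem_range_of_leeCoord_ne_zero H hG hH hpG hpH t ?_ ?_
  · rw [LinearEquiv.apply_symm_apply, Pi.single_eq_same]; exact one_ne_zero
  · rw [LinearEquiv.apply_symm_apply, Pi.single_eq_same]; exact one_ne_zero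

/-- **The class of the merged canonical generator in `Kh'⁰(G # H)` is nonzero** (homology-level
form of Prop. 4.1 for the merge map; `LeeHomologyZero` is definitionally the quotient module
`LeeH0 = leeCycles ⧸ leeBoundaries`). [cite: Rasmussen2010, Prop. 4.1] -/
theorem mk_mergeMap_leeState₀_ne_zero (hpG : ∀ i, (G.overPos i).val % 2 ≠ (G.underPos i).val % 2)
    (hpH : ∀ j, (H.overPos j).val % 2 ≠ (H.underPos j).val % 2) (t : Bool) :
    (Submodule.Quotient.mk (⟨G.mergeMap H hG hH 0 1 0 0 0
        ((G.leeCoord 0).symm (Pi.single (G.leeState₀ hpG t) 1))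
        ((H.leeCoord 0).symm (Pi.single (H.leeState₀ hpH t) 1)),
      G.mergeMap_leeState₀_mem_leeCycles H hG hH hpG hpH t t⟩ : (G.connSum H).leeCycles) :
        (G.connSum H).LeeHomologyZero) ≠ 0 :=
  fun h0 ↦ G.mergeMap_leeState₀_not_mem_range H hG hH hpG hpH t
    ((Submodule.Quotient.mk_eq_zero (p := (G.connSum H).leeBoundaries)).1 h0)

/-- **Homology-level Prop. 4.1 for the merge map**: in `Kh'⁰(G # H)` (the quotient module `LeeH0`)
the class of `m(ŝ_t(G), ŝ_t(H))` is the nonzero multiple `leeSign (¬t)` of the class of the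
canonical generator `ŝ_t(G # H)`. [cite: Rasmussen2010, Prop. 4.1] -/
theorem mk_mergeMap_leeState₀_eq_smul (hpG : ∀ i, (G.overPos i).val % 2 ≠ (G.underPos i).val % 2)
    (hpH : ∀ j, (H.overPos j).val % 2 ≠ (H.underPos j).val % 2)
    (hpD : ∀ k, ((G.connSum H).overPos k).val % 2 ≠ ((G.connSum H).underPos k).val % 2) (t : Bool) :
    (Submodule.Quotient.mk (⟨G.mergeMap H hG hH 0 1 0 0 0
        ((G.leeCoord 0).symm (Pi.single (G.leeState₀ hpG t) 1))
        ((H.leeCoord 0).symm (Pi.single (H.leeState₀ hpH t) 1)),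
      G.mergeMap_leeState₀_mem_leeCycles H hG hH hpG hpH t t⟩ : (G.connSum H).leeCycles) :
        (G.connSum H).LeeH0) =
      leeSign (!t) • Submodule.Quotient.mk
        (⟨((G.connSum H).leeCoord 0).symm (Pi.single ((G.connSum H).leeState₀ hpD t) 1),
          leeCoord_symm_single_mem_leeCycles ((G.connSum H).not_free_leeState hpD t)⟩ :
          (G.connSum H).leeCycles) := by
  rw [← Submodule.Quotient.mk_smul]
  congr 1
  apply Subtype.ext
  simp only [Submodule.coe_smul]
  exact G.mergeMap_leeState₀ H hG hH hpG hpH hpD t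

end Canonical

end GaussDiagram

end Literature.Topology.FourManifolds
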